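/-
Copyright: the b2b-balaban cell (near-miss cell 7), T⁴-continuum CRUX team (coordinator ruling e34b3e0c item (2)),
seat t4-ne7b-formalise-leaf-05 (gen 67). Released under the licence of the surrounding project.
-/
import Summits.QuantumFields.BalabanUV.T4Continuum.Spine.NE7b.ScreeningGrowthLemma

/-!
# The growth lemma S4 of R-SI: step counts linear in `Cb/ε₀` and logarithmic in `Ca`
# (estimate NE7b, `t4/ROUTES-NE7b.md` v12, block «WHAT CHANGED v11.3 → v12» item (3), step S4 — its explicit `k₁`)

`…Spine.NE7b.ScreeningGrowthLemma` proves S4's double-exponential bound from the index `⌈Ca²⌉₊ + ⌈2Cb⁴/ε₀⁴⌉₊`, using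
only Bernoulli in the small phase and only the increment `ε₀` in the large phase. ROUTES-NE7b v12 states the onset as
«`k₁ ≤ (C_a+1) ln C_a + 2C_b/ε₀ + 2`». THIS FILE sharpens the kernel count to the same SHAPE — logarithmic in `Ca`, LINEAR
in `Cb/ε₀` — with explicit constants (standing hypothesis `h` = the conjunction of the prequel):
* `exp_le_one_add_inv` — `exp (1/(Ca+1)) ≤ 1 + 1/Ca`; `large_of_log_lt` — the small phase is over at every index
  `k > (Ca+1)·log Ca` (instead of `k ≥ Ca²`);
* `one_le_poly_aux` — `1 ≤ (1+t)(1−t/6)³` on `[0,1]`; `inv_cbrt_step` — in the large phase, while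
  `(ε₀/Cb)·(E k/Cb)^{1/3} ≤ 1`, the potential `1/(E k/Cb)^{1/3}` DROPS by at least `(ε₀/Cb)/6` per step
  (from `E (k+1) ≥ E k + ε₀ (E k/Cb)^{4/3}`); `inv_cbrt_iter` — iterated;
* `cb_le_at` — `Cb ≤ E (k₀ + ⌈Cb/ε₀⌉₊)` once the large phase holds at `k₀`; `threshold_sharp` — from `Cb ≤ E k₀` (large
  phase) the double-exponential threshold `2Cb⁴/ε₀³ ≤ E k` is reached at `k = k₀ + ⌈6·Cb/ε₀⌉₊ + 1`;
* `dexp_lower_sharp` — `(Cb⁴/ε₀³)·2^{(4/3)^j} ≤ E (k₀ + ⌈Cb/ε₀⌉₊ + ⌈6·Cb/ε₀⌉₊ + 1 + j)` for every `k₀ > (Ca+1)·log Ca`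
  and every `j`: S4's «log E_k grows like (4/3)^{k−k₁}» with `k₁ = k₀ + ⌈Cb/ε₀⌉₊ + ⌈6Cb/ε₀⌉₊ + 1`, i.e.
  `k₁ ≤ (Ca+1) log Ca + 7·Cb/ε₀ + 4`.

INFO (located, zero weight). v12's `2C_b/ε₀ + 2` for the same onset is SHORTER than what this argument certifies
(`7·Cb/ε₀ + O(1)` after the small phase) and than the continuum heuristic for `u' = δu^{4/3}` from `u = 1` (`3/δ` after
the `1/δ` steps needed to reach `u = 1`, `δ = ε₀/Cb`, `u = E/Cb`): the linear SHAPE of v12's count is confirmed, its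
constant `2` is not (it may refer to the `Cb`-crossing rather than to the onset of `(4/3)`-growth of `log E`). R-SI's
`C_MP = C·16^{k*}` is «effective but astronomical» under either constant; nothing of NE7b's bookkeeping depends on it.

HONEST FRAMING. Law-free real analysis about one real sequence; nothing of S1–S3, S6, (★), ε-regularity or gauge
fields; nothing of [Bałaban 1983–89] read, asserted or cited. R-SI stays «rank 3 CANDIDATE, 0 seats, unfunded, price
HIGH»; C-RH° stays KILL PROPOSED 2026-08-28 with the author's concurrence. NE7b (`T4WeightBudget.RelWeightBound`) NOT
PRINTED and NOT PROVED; spine PROVED 0∕9; rung (B)+1 on a FINITE torus T⁴ — NOT infinite volume, NOT the mass gap, NOT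
Clay. HONEST DEPENDENCY: continuum YM on T⁴ ⇐ BetaPertH ∧ nine spine estimates (0/9 proved); BetaPertH ⇐ (D1) ∧ (D4) ∧
CAP+tail; G-an2-4 gates asym, D1 and NE2/3/4. POLICY: crux-route work under `Spine/NE7b/`, not a `T4Continuum/Support`
leaf (FREEZE (0) respected); 0 `def`, no `Prop`-valued fact, no `[cite:]` fact.
-/

set_option autoImplicit false

namespace Summit.QuantumFields.BalabanUV.T4Continuum.NE7b.ScreeningGrowth

/-! ## §1 Two hypothesis-free inequalities -/

/-- `exp (1/(C+1)) ≤ 1 + 1/C` for `C > 0` (from `1 − y ≤ exp (−y)` at `y = 1/(C+1)`). -/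
theorem exp_le_one_add_inv {C : ℝ} (hC : 0 < C) : Real.exp (1 / (C + 1)) ≤ 1 + 1 / C := by
  have h1 : -(1 / (C + 1)) + 1 ≤ Real.exp (-(1 / (C + 1))) := Real.add_one_le_exp _
  have h2 : -(1 / (C + 1)) + 1 = C / (C + 1) := by field_simp; ring
  rw [h2, Real.exp_neg] at h1
  -- h1 : C/(C+1) ≤ (exp (1/(C+1)))⁻¹
  have hpos : 0 < Real.exp (1 / (C + 1)) := Real.exp_pos _
  have h3 : C / (C + 1) * Real.exp (1 / (C + 1)) ≤ 1 := by
    have := mul_le_mul_of_nonneg_right h1 hpos.le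
    rwa [inv_mul_cancel₀ hpos.ne'] at this
  have h4 : 1 + 1 / C = (C + 1) / C := by field_simp
  rw [h4, le_div_iff₀ hC]
  have h5 : C / (C + 1) * Real.exp (1 / (C + 1)) * (C + 1) ≤ 1 * (C + 1) :=
    mul_le_mul_of_nonneg_right h3 (by linarith)
  have h6 : C / (C + 1) * Real.exp (1 / (C + 1)) * (C + 1) = Real.exp (1 / (C + 1)) * C := by
    field_simp
  linarith

/-- The polynomial inequality behind the cube-root potential: `1 ≤ (1 + t)(1 − t/6)³` for `t ∈ [0, 1]`
(`(1+t)(1−t/6)³ − 1 = t·(1/2 − 5t/12 + t²(17 − t)/216)`). -/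
theorem one_le_poly_aux {t : ℝ} (ht0 : 0 ≤ t) (ht1 : t ≤ 1) : 1 ≤ (1 + t) * (1 - t / 6) ^ 3 := by
  have h1 : (1 + t) * (1 - t / 6) ^ 3 - 1 = t * (1 / 2 - 5 * t / 12 + t ^ 2 * (17 - t) / 216) := by ring
  have h2 : 0 ≤ t * (1 / 2 - 5 * t / 12 + t ^ 2 * (17 - t) / 216) := by
    apply mul_nonneg ht0
    have : 0 ≤ t ^ 2 * (17 - t) / 216 := by
      apply div_nonneg _ (by norm_num)
      exact mul_nonneg (sq_nonneg t) (by linarith)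
    linarith
  linarith

variable {E : ℕ → ℝ} {ε₀ Ca Cb : ℝ}
  (h : 0 < ε₀ ∧ 0 < Ca ∧ 0 < Cb ∧ ε₀ ≤ E 0 ∧ ∀ k : ℕ,
    (E (k + 1) - E k ≤ ε₀ ∧ E k ≤ Ca * (E (k + 1) - E k)) ∨
    (ε₀ ≤ E (k + 1) - E k ∧ E k ≤ Cb * ((E (k + 1) - E k) / ε₀) ^ (3 / 4 : ℝ)))
include h

/-! ## §2 The small phase ends after `(Ca+1)·log Ca` steps -/

/-- EXIT of the small phase, logarithmic count: `Ca·ε₀ < E k` for every index `k > (Ca+1)·log Ca`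
(`(1+1/Ca)^k ≥ exp (k/(Ca+1)) > exp (log Ca) = Ca`). -/
theorem large_of_log_lt (k : ℕ) (hk : (Ca + 1) * Real.log Ca < k) : Ca * ε₀ < E k := by
  rcases lt_or_ge (Ca * ε₀) (E k) with hlt | hle
  · exact hlt
  exfalso
  have hCa := h.2.1
  have hε := h.1
  have hsmall : ∀ j < k, E j ≤ Ca * ε₀ := fun j hj => le_trans (term_le_term h hj.le) hle
  have h1 := small_phase_lower h k hsmall
  -- (1 + 1/Ca)^k ≥ exp(1/(Ca+1))^k = exp (k/(Ca+1)) > Ca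
  have h2 : Real.exp (1 / (Ca + 1)) ^ k ≤ (1 + 1 / Ca) ^ k :=
    pow_le_pow_left₀ (Real.exp_pos _).le (exp_le_one_add_inv hCa) k
  have h3 : Real.exp (1 / (Ca + 1)) ^ k = Real.exp ((k : ℝ) * (1 / (Ca + 1))) := by
    rw [← Real.exp_nat_mul]
  have h4 : Real.log Ca < (k : ℝ) * (1 / (Ca + 1)) := by
    rw [mul_one_div, lt_div_iff₀ (by linarith)]
    linarith
  have h5 : Ca < Real.exp ((k : ℝ) * (1 / (Ca + 1))) := by
    calc Ca = Real.exp (Real.log Ca) := (Real.exp_log hCa).symm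
      _ < Real.exp ((k : ℝ) * (1 / (Ca + 1))) := Real.exp_lt_exp.2 h4
  have h6 : ε₀ * Ca < ε₀ * (1 + 1 / Ca) ^ k := by
    apply mul_lt_mul_of_pos_left _ hε
    calc Ca < Real.exp ((k : ℝ) * (1 / (Ca + 1))) := h5
      _ = Real.exp (1 / (Ca + 1)) ^ k := h3.symm
      _ ≤ (1 + 1 / Ca) ^ k := h2
  linarith

/-! ## §3 The cube-root potential in the large phase: `Cb/ε₀`-linear count to the double-exponential threshold -/

/-- ONE STEP of the potential: in the large phase, while `(ε₀/Cb)·(E k/Cb)^{1/3} ≤ 1`, the quantity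
`1/(E k/Cb)^{1/3}` drops by at least `(ε₀/Cb)/6` (uses `E (k+1) ≥ E k + ε₀ (E k/Cb)^{4/3}` and `one_le_poly_aux`). -/
theorem inv_cbrt_step (k : ℕ) (hk : Ca * ε₀ < E k) (ht : ε₀ / Cb * (E k / Cb) ^ (1 / 3 : ℝ) ≤ 1) :
    1 / (E (k + 1) / Cb) ^ (1 / 3 : ℝ) ≤ 1 / (E k / Cb) ^ (1 / 3 : ℝ) - ε₀ / Cb / 6 := by
  have hε := h.1
  have hCb := h.2.2.1
  have hu : 0 < E k / Cb := div_pos (pos h k) hCb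
  have hu' : 0 < E (k + 1) / Cb := div_pos (pos h (k + 1)) hCb
  set u := E k / Cb with hu_def
  set u' := E (k + 1) / Cb with hu'_def
  set w := u ^ (1 / 3 : ℝ) with hw_def
  set δ := ε₀ / Cb with hδ_def
  have hw : 0 < w := Real.rpow_pos_of_pos hu _
  have hδ : 0 < δ := div_pos hε hCb
  set t := δ * w with ht_def
  have ht0 : 0 ≤ t := by positivity
  -- the large-phase law in `u`-units: u' ≥ u + δ u^{4/3} = u (1 + t)
  have hs := large_step h k hk
  have hs' : ε₀ * (E k / Cb) ^ (4 / 3 : ℝ) ≤ E (k + 1) - E k := by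
    have := mul_le_mul_of_nonneg_left (le_max_right 1 ((E k / Cb) ^ (4 / 3 : ℝ))) hε.le
    linarith
  have h43 : u ^ (4 / 3 : ℝ) = u * w := by
    rw [hw_def, show (4 / 3 : ℝ) = 1 + 1 / 3 by norm_num, Real.rpow_add hu, Real.rpow_one]
  have hstep : u * (1 + t) ≤ u' := by
    rw [hu'_def, hu_def, ht_def, hδ_def, le_div_iff₀ hCb]
    have : E k / Cb * (1 + ε₀ / Cb * w) * Cb = E k + ε₀ * (E k / Cb * w) := by
      field_simp
    rw [this, ← h43]
    linarith
  -- u = w³ and the polynomial inequality give u' ≥ (w/(1 - t/6))³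
  have hw3 : w ^ (3 : ℕ) = u := by
    rw [hw_def, ← Real.rpow_natCast, ← Real.rpow_mul hu.le]
    norm_num
  have hσ : 0 < 1 - t / 6 := by linarith
  have hpoly := one_le_poly_aux ht0 ht
  have hcube : (w / (1 - t / 6)) ^ (3 : ℕ) ≤ u' := by
    rw [div_pow, div_le_iff₀ (pow_pos hσ 3), hw3]
    calc u = u * 1 := (mul_one u).symm
      _ ≤ u * ((1 + t) * (1 - t / 6) ^ 3) := mul_le_mul_of_nonneg_left hpoly hu.le
      _ = u * (1 + t) * (1 - t / 6) ^ 3 := by ring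
      _ ≤ u' * (1 - t / 6) ^ 3 := mul_le_mul_of_nonneg_right hstep (pow_pos hσ 3).le
  -- take cube roots
  have hwσ : 0 ≤ w / (1 - t / 6) := div_nonneg hw.le hσ.le
  have hroot : w / (1 - t / 6) ≤ u' ^ (1 / 3 : ℝ) := by
    have h1 : ((w / (1 - t / 6)) ^ (3 : ℕ)) ^ (1 / 3 : ℝ) ≤ u' ^ (1 / 3 : ℝ) :=
      Real.rpow_le_rpow (pow_nonneg hwσ 3) hcube (by norm_num)
    have h2 : ((w / (1 - t / 6)) ^ (3 : ℕ)) ^ (1 / 3 : ℝ) = w / (1 - t / 6) := by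
      rw [← Real.rpow_natCast, ← Real.rpow_mul hwσ]
      norm_num
    rw [h2] at h1
    exact h1
  -- invert
  have hw' : 0 < u' ^ (1 / 3 : ℝ) := Real.rpow_pos_of_pos hu' _
  have hfin : 1 / (w / (1 - t / 6)) = 1 / w - δ / 6 := by
    rw [one_div_div, ht_def, sub_div, div_div, mul_div_mul_right _ _ hw.ne']
  calc 1 / u' ^ (1 / 3 : ℝ) ≤ 1 / (w / (1 - t / 6)) :=
        one_div_le_one_div_of_le (div_pos hw hσ) hroot
    _ = 1 / w - δ / 6 := hfin

/-- ITERATED potential: if the large phase holds at `k₀` and `(ε₀/Cb)·(E (k₀+i)/Cb)^{1/3} ≤ 1` for all `i < m`, then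
`1/(E (k₀+m)/Cb)^{1/3} ≤ 1/(E k₀/Cb)^{1/3} − m·(ε₀/Cb)/6`. -/
theorem inv_cbrt_iter (k₀ m : ℕ) (hk : Ca * ε₀ < E k₀)
    (hall : ∀ i < m, ε₀ / Cb * (E (k₀ + i) / Cb) ^ (1 / 3 : ℝ) ≤ 1) :
    1 / (E (k₀ + m) / Cb) ^ (1 / 3 : ℝ) ≤ 1 / (E k₀ / Cb) ^ (1 / 3 : ℝ) - m * (ε₀ / Cb / 6) := by
  induction m with
  | zero => simp
  | succ m ih =>
    have ih' := ih fun i hi => hall i (Nat.lt_succ_of_lt hi)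
    have hkm : Ca * ε₀ < E (k₀ + m) := lt_of_lt_of_le hk (term_le_term h (Nat.le_add_right k₀ m))
    have hs := inv_cbrt_step h (k₀ + m) hkm (hall m (Nat.lt_succ_self m))
    have he : k₀ + (m + 1) = k₀ + m + 1 := rfl
    rw [he]
    push_cast
    linarith

/-- `Cb ≤ E (k₀ + ⌈Cb/ε₀⌉₊)` once the large phase holds at `k₀` (increment `≥ ε₀` per step). -/
theorem cb_le_at (k₀ : ℕ) (hk : Ca * ε₀ < E k₀) : Cb ≤ E (k₀ + ⌈Cb / ε₀⌉₊) := by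
  have h1 := linear_lower h k₀ hk ⌈Cb / ε₀⌉₊
  have h2 : Cb ≤ (⌈Cb / ε₀⌉₊ : ℝ) * ε₀ := by
    have := Nat.le_ceil (Cb / ε₀)
    rwa [div_le_iff₀ h.1] at this
  have h3 : 0 < E k₀ := pos h k₀
  linarith

/-- SHARP THRESHOLD: if the large phase holds at `k₀` and `Cb ≤ E k₀`, then `2·Cb⁴/ε₀³ ≤ E (k₀ + ⌈6·Cb/ε₀⌉₊ + 1)`
(the potential cannot drop `⌈6Cb/ε₀⌉₊` times from `≤ 1`, so some earlier step has `(ε₀/Cb)(E/Cb)^{1/3} > 1`, i.e.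
`E > Cb⁴/ε₀³`, and the next step more than doubles `E`). -/
theorem threshold_sharp (k₀ : ℕ) (hk : Ca * ε₀ < E k₀) (hCb : Cb ≤ E k₀) :
    2 * Cb ^ 4 / ε₀ ^ 3 ≤ E (k₀ + ⌈6 * Cb / ε₀⌉₊ + 1) := by
  have hε := h.1
  have hCb0 := h.2.2.1
  set M := ⌈6 * Cb / ε₀⌉₊ with hM
  -- not all of the first M steps can be potential steps
  have hex : ∃ i, i < M ∧ 1 < ε₀ / Cb * (E (k₀ + i) / Cb) ^ (1 / 3 : ℝ) := by
    by_contra hno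
    have hall : ∀ i < M, ε₀ / Cb * (E (k₀ + i) / Cb) ^ (1 / 3 : ℝ) ≤ 1 := by
      intro i hi
      exact le_of_not_gt fun hgt => hno ⟨i, hi, hgt⟩
    have hit := inv_cbrt_iter h k₀ M hk hall
    have hu0 : 1 ≤ E k₀ / Cb := by rw [le_div_iff₀ hCb0]; linarith
    have hw0 : 1 ≤ (E k₀ / Cb) ^ (1 / 3 : ℝ) := Real.one_le_rpow hu0 (by norm_num)
    have hinv0 : 1 / (E k₀ / Cb) ^ (1 / 3 : ℝ) ≤ 1 := by
      rw [div_le_iff₀ (by linarith)]; linarith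
    have hMge : 6 * Cb / ε₀ ≤ (M : ℝ) := Nat.le_ceil _
    have hMδ : 1 ≤ (M : ℝ) * (ε₀ / Cb / 6) := by
      rw [div_le_iff₀ hε] at hMge
      have : (M : ℝ) * (ε₀ / Cb / 6) = (M : ℝ) * ε₀ / (6 * Cb) := by ring
      rw [this, le_div_iff₀ (by positivity)]
      linarith
    have hpos : 0 < 1 / (E (k₀ + M) / Cb) ^ (1 / 3 : ℝ) :=
      one_div_pos.2 (Real.rpow_pos_of_pos (div_pos (pos h (k₀ + M)) hCb0) _)
    linarith
  obtain ⟨i, hiM, hbig⟩ := hex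
  -- at step k₀ + i: E/Cb > (Cb/ε₀)³, and the next step more than doubles it
  have hki : Ca * ε₀ < E (k₀ + i) := lt_of_lt_of_le hk (term_le_term h (Nat.le_add_right k₀ i))
  have hu : 0 < E (k₀ + i) / Cb := div_pos (pos h (k₀ + i)) hCb0
  set u := E (k₀ + i) / Cb with hu_def
  set w := u ^ (1 / 3 : ℝ) with hw_def
  have hw : 0 < w := Real.rpow_pos_of_pos hu _
  have hw3 : w ^ (3 : ℕ) = u := by
    rw [hw_def, ← Real.rpow_natCast, ← Real.rpow_mul hu.le]
    norm_num
  -- from ε₀/Cb * w > 1: w > Cb/ε₀, so u = w³ > (Cb/ε₀)³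
  have hwgt : Cb / ε₀ < w := by
    have hbig' : 1 < w * (ε₀ / Cb) := by rwa [mul_comm] at hbig
    have hce : Cb / ε₀ = 1 / (ε₀ / Cb) := by rw [one_div_div]
    rw [hce, div_lt_iff₀ (div_pos hε hCb0)]
    exact hbig'
  have hugt : (Cb / ε₀) ^ 3 < u := by
    rw [← hw3]
    exact pow_lt_pow_left₀ hwgt (by positivity) (by norm_num)
  -- next step: E (k₀+i+1) ≥ E (k₀+i) + ε₀ u^{4/3} = Cb·u·(1 + (ε₀/Cb) w) > 2·Cb·u > 2 Cb⁴/ε₀³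
  have hs := large_step h (k₀ + i) hki
  have hs' : ε₀ * u ^ (4 / 3 : ℝ) ≤ E (k₀ + i + 1) - E (k₀ + i) := by
    have := mul_le_mul_of_nonneg_left (le_max_right 1 (u ^ (4 / 3 : ℝ))) hε.le
    linarith
  have h43 : u ^ (4 / 3 : ℝ) = u * w := by
    rw [hw_def, show (4 / 3 : ℝ) = 1 + 1 / 3 by norm_num, Real.rpow_add hu, Real.rpow_one]
  have hEi : E (k₀ + i) = Cb * u := by rw [hu_def]; field_simp
  have hnext : 2 * Cb ^ 4 / ε₀ ^ 3 < E (k₀ + i + 1) := by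
    have h1 : ε₀ * (u * w) > Cb * u := by
      -- ε₀ w > Cb since w > Cb/ε₀
      have : Cb < ε₀ * w := by rwa [div_lt_iff₀' hε] at hwgt
      nlinarith
    have h2 : Cb * u > Cb * (Cb / ε₀) ^ 3 := mul_lt_mul_of_pos_left hugt hCb0
    have h3 : Cb * (Cb / ε₀) ^ 3 = Cb ^ 4 / ε₀ ^ 3 := by field_simp
    have h4 : (2 : ℝ) * Cb ^ 4 / ε₀ ^ 3 = 2 * (Cb ^ 4 / ε₀ ^ 3) := by ring
    rw [h43] at hs'
    rw [h4]
    linarith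
  have hidx : k₀ + i + 1 ≤ k₀ + M + 1 := by omega
  exact le_trans hnext.le (term_le_term h hidx)

/-- S4's double-exponential bound from a `Cb/ε₀`-LINEAR, `log Ca`-LOGARITHMIC index: for every `k₀ > (Ca+1)·log Ca`
and every `j`, `(Cb⁴/ε₀³)·2^{(4/3)^j} ≤ E (k₀ + ⌈Cb/ε₀⌉₊ + ⌈6·Cb/ε₀⌉₊ + 1 + j)`. -/
theorem dexp_lower_sharp (k₀ : ℕ) (hk₀ : (Ca + 1) * Real.log Ca < k₀) (j : ℕ) :
    Cb ^ 4 / ε₀ ^ 3 * (2 : ℝ) ^ ((4 / 3 : ℝ) ^ j) ≤ E (k₀ + ⌈Cb / ε₀⌉₊ + ⌈6 * Cb / ε₀⌉₊ + 1 + j) := by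
  have hε := h.1
  have hCb := h.2.2.1
  have hk : Ca * ε₀ < E k₀ := large_of_log_lt h k₀ hk₀
  set k₀' := k₀ + ⌈Cb / ε₀⌉₊ with hk₀'
  have hk' : Ca * ε₀ < E k₀' := lt_of_lt_of_le hk (term_le_term h (Nat.le_add_right _ _))
  have hCb' : Cb ≤ E k₀' := cb_le_at h k₀ hk
  set k₁ := k₀' + ⌈6 * Cb / ε₀⌉₊ + 1 with hk₁
  have hk1 : Ca * ε₀ < E k₁ := lt_of_lt_of_le hk' (term_le_term h (by omega))
  have hT : 2 * Cb ^ 4 / ε₀ ^ 3 ≤ E k₁ := threshold_sharp h k₀' hk' hCb'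
  have hv : 2 ≤ E k₁ * ε₀ ^ 3 / Cb ^ 4 := by
    rw [le_div_iff₀ (by positivity)]
    rw [div_le_iff₀ (by positivity)] at hT
    linarith
  have hd := dexp_lower h k₁ hk1 hv j
  rw [le_div_iff₀ (by positivity)] at hd
  have hidx : k₀ + ⌈Cb / ε₀⌉₊ + ⌈6 * Cb / ε₀⌉₊ + 1 + j = k₁ + j := by simp only [hk₁, hk₀']
  rw [hidx, div_mul_eq_mul_div, div_le_iff₀ (by positivity)]
  linarith

end Summit.QuantumFields.BalabanUV.T4Continuum.NE7b.ScreeningGrowth
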